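import Literature.AnabelianGeometry.EtaleTheta.Discharge.Sec5OfThetaSetting
import Literature.AnabelianGeometry.EtaleTheta.Discharge.Sec5KummerGaloisDictionary
import Literature.AnabelianGeometry.EtaleTheta.Discharge.Sec2GaloisDictionaryOfSetting
import Literature.AnabelianGeometry.EtaleTheta.Discharge.Sec5RootCocycleDiesOfDictionary

/-!
# [EtTh] §5 ↔ §2 dictionary AT THE JUNCTION `ofThetaSettingData`: what F-1306 (`CyclotomicCharacterCompatX`) and F-0521
# (`ThetaSectionCompat`) reduce to over the §1 Setting (Lemma 5.8 proof p. 331, Prop. 5.2 (iii) p. 324 / PDF pp. 105, 98)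

Mochizuki, *The étale theta function and its Frobenioid-theoretic manifestations*, Publ. RIMS **45** (2009)
[cite: MochizukiEtTh2009, Lem 5.8 proof p.331 (PDF p.105); Prop 5.2 (iii) p.324 (PDF p.98)].  abc-iut cell, layer L2, row R212 of
abc-iut-L2-lead (gen 3) «F-0521 hcompat / F-1306 producer (or reduction) at the junction `ofThetaSettingData`»; seat abc-iut-f-125
(gen 2).  PROOF-ONLY (no `def`, no instance, no new `Prop` fact; nothing landed is edited or restated) over abc-iut-L2-t4's junction
`Discharge/Sec5OfThetaSetting.lean` (p433549: the §5 data with `X := Π^tp_X̲̲ = C.Huu`, `T := C.thetaEnvData μ hC hS`, `ιX := id`),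
abc-iut-L2-t11's `Sec5KummerGaloisDictionary.lean` (the constants dictionary ⇒ `CyclotomicCharacterCompatX`) and
`Sec2GaloisDictionaryOfSetting.lean` (the `T`-side of that dictionary DISCHARGED at the Setting), abc-iut-f-116's
`Sec5EnvelopeTopologyDictionary.lean` and abc-iut-L6-t23's `Sec5RootCocycleDiesOfDictionary.lean` (p431475, whose binders
`hYdd` / `hcompat` / `hχX` at `ofConnectedTemperoidData` with `ι := id` are the consumers served here).

VERDICT OF THE SIZING (STATUS 10:05Z).  At the junction the tempered Frobenioid `tf` over `B^temp(Π^tp_X̲̲)⁰`, the constants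
`K', constEmb` and the «`Θ̈`» slot `θ` are FREE parameters (p433549 header, "RESIDUAL INPUTS"), so neither the Galois action on
`μ_N(B_N) ⊆ O^×(B_N)` (F-1306) nor the class of the bi-Kummer difference cocycle (F-0521) is constrained by the junction's fields
(kernel witnesses of record: abc-iut-f-116's `exists_cyclotomicCharacterCompat_not_compatX`, `not_forall_thetaSectionCompat`).  What the
junction DOES give is proved here:
* `identifiesPiYdd_ofBiKummerData`, `identifiesPiYdd_ofThetaSettingData` — the consumers' binder `hYdd : IdentifiesPiYdd T id` is
  `Iff.rfl` for every assembled §5 datum (`𝔉.PiYdd = T.PiYdd` on the nose), in particular `Π^tp_Ÿ̲̲` of the Setting;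
* **F-1306 `cyclotomicCharacterCompatX_ofThetaSettingData_of_constantsDictionary`** — abc-iut-L2-t11's
  `cyclotomicCharacterCompatX_of_galoisDictionary` at `𝔉 := ofThetaSettingData`, `α := biratAutAction_ofConnectedTemperoidData hconst`,
  with the `T`-SIDE OF THE DICTIONARY DISCHARGED at the Setting (`e := fixingSubgroupMulEquiv K refl : G_K ≃* Gal(ℚ̄_p/K)`,
  `j := μ_N(ℚ̄_p) ↪ ℚ̄_p^×`, `hj`, `hchi := thetaEnvData_chi_dictionary` — "`χ` IS the Galois action", Def. 2.10 p. 270); the residual is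
  the `tf`-side CONSTANTS DICTIONARY {`hconst` (Def. 3.6 (iii)), `hK : KxRootNModCyclotome` (Lemma 5.8 "`(K^×)^{1/N}/μ_N(B_N) ⥲ K^×`"),
  `ν : (K^×)^{1/N} →* ℚ̄_p^×` with `hνμ`, `hνeq` ("`Π^tp_Y` [i.e., `G_K`, via `Π^tp_Y ↠ G_K`] acts … via multiplication by an element of
  `μ_N(B_N)`", Lemma 5.8 proof p. 331)} — the SAME package from which abc-iut-L2-t11 already derives `hgeom` / `hKumC` / `hroot`; so at
  the junction F-1306 JOINS that single origin clause ("the `N`-th roots of constants of `tf` at `B_N` are `p`-adic algebraic numbers,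
  `Π^tp_X̲̲ ↠ G_K`-equivariantly") and contributes no clause of its own; `hD1_ofThetaSettingData_of_constantsDictionary` feeds
  abc-iut-L6-t23's (D1) with it;
* **F-0521 `thetaSectionCompat_ofThetaSettingData_iff` / `exists_thetaSectionCompat_mem_ofThetaSettingData_iff`** — at the junction
  the Prop. 5.2 (iii) dictionary for `η` reads `∀ k ∈ Π^tp_Ÿ̲̲, m(d(k)) = η(k)⁻¹` (`ι = id`, no transport), and "some cocycle OF THE CLASS
  satisfies it" iff **`(m ∘ d)⁻¹ ∈ C.thetaCocycles hC μ`** — the transported bi-Kummer difference cocycle `d(k) = s^⊔-gp_N(ρ k)·s^⊓-gp_N(ρ k)⁻¹`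
  of the §5 data IS the reduction mod `N` of a member of the orbit `η̲̈^{Θ,l·ℤ×μ₂}` of the §1 étale theta class: print's Prop. 5.2 (iii)
  AT THE SETTING, irreducible while `θ` is free (it is what the junction `θ := Θ̈` of abc-iut-L2-t10's `DoubleUnderline` data,
  GAP-LEDGER G-L2t4-2, must deliver); meanwhile the dictionary HOLDS for the transported cocycle itself
  (`thetaSectionCompat_ofBiKummerData_transport`, `…_ofThetaSettingData_transport`), so abc-iut-L6-t23's `hdies` / (D2) at the junction are
  UNCONDITIONAL for that cocycle (`hdies_ofThetaSettingData`).
HONEST FRAMING: kernel-checked bookkeeping over the typed interfaces; `tf`, `K'`, `constEmb`, `θ` stay abstract parameters (not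
inhabited for the curve); nothing of [EtTh] is asserted unconditionally; a FACT row is an assumption label; nothing here bears on
[IUTchIII] Cor. 3.12 and no side is taken; typed ≠ proved.
-/

noncomputable section

namespace Literature.AnabelianGeometry.EtaleTheta

open CategoryTheory Opposite Literature.AlgebraicGeometry.Frobenioids Literature.AnabelianGeometry.SemiGraphs
  Literature.AnabelianGeometry.SemiGraphs.GaloisObjects Literature.AlgebraicGeometry.Frobenioids.QuasiTemperoid.BTempConnected

universe u₀ v₀ u v w

namespace ThetaFrobenioid

/-! ### `hYdd` and the transported cocycle for EVERY assembled §5 datum `ofBiKummerData` (`ι := id`) -/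

section OfBiKummerData

variable {K : Type u₀} [Field K] {X : SemiGraphs.TemperedArithmeticGroup.{u₀} K} {D₀ : Type u₀} [Category.{v₀} D₀]
  {V : FrdIMonoidStub.{w}} {T₀ : RealifiedDivisorMonoids (D₀ := D₀) V} {D : Type u} [Category.{v} D]
  {VD : FrdICatStub.{u, v, w} D} {S : BiKummerSetting X T₀ D VD}
  {pullFrac : ∀ {A A' : S.C} (_ : A' ⟶ A), S.biratUnits A → S.biratUnits A'}
  {lv N : ℕ+} {T : ThetaEnvData.{max v w} N} {θ : S.biratUnits S.Aodot} {Bl : S.C}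
  {Pl : S.FractionPair θ Bl} {Rl : S.NthRoot θ Pl lv pullFrac}
  (h : ModelFrobenioid.Hypotheses S.tf.divisorMonoid S.tf.ratFnFunctor)
  (toB : ∀ A : S.C, S.biratUnits A →* S.tf.biratUnitsModel A) (Q : FrobenioidTheta.ThetaSubquotientStub.{w} D)
  (odd_l : Odd (lv : ℕ)) (R : S.NthRoot Rl.root Rl.pair N pullFrac) (ιX : T.PiX ≃ₜ* X.Pi)
  (hopen : IsOpen ((S.galoisSurj R.AN.base R.αData.isGalois).ker : Set X.Pi)) (σ : Aut R.AN.base →* Aut R.AN)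
  (K' : Type w) [Field K'] (constEmb : K'ˣ →* S.tf.biratUnitsModel R.BN)
  (constEmb_injective : Function.Injective constEmb)
  (hdivc : ∀ g : Aut R.BN.base,
    ModelFrobenioid.div ((σ ((BiKummerSetting.NthRoot.baseIso S R).conjAut.symm g)).hom ≫ R.pair.num) =
      ModelFrobenioid.div R.pair.num)
  (hdivp : ∀ y : T.PiYdd,
    ModelFrobenioid.div ((σ (S.galoisSurj R.AN.base R.αData.isGalois (ιX y.1))).hom ≫ R.pair.den) =
      ModelFrobenioid.div R.pair.den)

/-- **The binder `hYdd` is free for every assembled §5 datum**: `ofBiKummerData` has `Π^tp_Ÿ̲ := T.PiYdd` on the nose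
(`ofBiKummerData_PiYdd`), so `id` identifies `Π^tp_Ÿ̲` with `Π^tp_Ÿ` (`IdentifiesPiYdd T id`) by `Iff.rfl` — the hypothesis `hYdd` of
abc-iut-L6-t23's `hdies_ofBiKummerData_of_thetaSectionCompat` / `…_ofConnectedTemperoidData_…` and of abc-iut-L2-t11's envelope
theorems is thereby DISCHARGED at all such data.  [cite: MochizukiEtTh2009, Lem 5.9 (iv) p.332 (PDF p.106)] -/
theorem identifiesPiYdd_ofBiKummerData :
    (ofBiKummerData h toB Q odd_l R ιX hopen σ K' constEmb constEmb_injective hdivc hdivp).IdentifiesPiYdd T (MulEquiv.refl _) :=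
  fun _ => Iff.rfl

/-- **The Prop. 5.2 (iii) dictionary in the `ι := id` coordinates of the assembled data**: `ThetaSectionCompat … id … η` says
exactly `∀ k ∈ Π^tp_Ÿ, m(d(k)) = η(k)⁻¹` — no transport.  [cite: MochizukiEtTh2009, Prop 5.2 (iii) p.324 (PDF p.98)] -/
theorem thetaSectionCompat_ofBiKummerData_iff
    (H : (ofBiKummerData h toB Q odd_l R ιX hopen σ K' constEmb constEmb_injective hdivc hdivp).Facts)
    (m : (ofBiKummerData h toB Q odd_l R ιX hopen σ K' constEmb constEmb_injective hdivc hdivp).muTorsion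
        (ofBiKummerData h toB Q odd_l R ιX hopen σ K' constEmb constEmb_injective hdivc hdivp).BN
        (ofBiKummerData h toB Q odd_l R ιX hopen σ K' constEmb constEmb_injective hdivc hdivp).N ≃* T.mu)
    (η : T.PiYdd → T.mu) :
    (ofBiKummerData h toB Q odd_l R ιX hopen σ K' constEmb constEmb_injective hdivc hdivp).ThetaSectionCompat H T
        (MulEquiv.refl _) m (identifiesPiYdd_ofBiKummerData h toB Q odd_l R ιX hopen σ K' constEmb constEmb_injective hdivc hdivp) η ↔
      ∀ k : T.PiYdd,
        m ((ofBiKummerData h toB Q odd_l R ιX hopen σ K' constEmb constEmb_injective hdivc hdivp).diffCocycle H k) = (η k)⁻¹ :=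
  Iff.rfl

/-- **The dictionary HOLDS for the transported cocycle** `η_𝔉 := k ↦ m(d(k))⁻¹` (abc-iut-f-116's `existsUnique_thetaSectionCompat`: it is
the ONLY such cocycle).  [cite: MochizukiEtTh2009, Prop 5.2 (iii) p.324 (PDF p.98)] -/
theorem thetaSectionCompat_ofBiKummerData_transport
    (H : (ofBiKummerData h toB Q odd_l R ιX hopen σ K' constEmb constEmb_injective hdivc hdivp).Facts)
    (m : (ofBiKummerData h toB Q odd_l R ιX hopen σ K' constEmb constEmb_injective hdivc hdivp).muTorsion
        (ofBiKummerData h toB Q odd_l R ιX hopen σ K' constEmb constEmb_injective hdivc hdivp).BN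
        (ofBiKummerData h toB Q odd_l R ιX hopen σ K' constEmb constEmb_injective hdivc hdivp).N ≃* T.mu) :
    (ofBiKummerData h toB Q odd_l R ιX hopen σ K' constEmb constEmb_injective hdivc hdivp).ThetaSectionCompat H T
        (MulEquiv.refl _) m (identifiesPiYdd_ofBiKummerData h toB Q odd_l R ιX hopen σ K' constEmb constEmb_injective hdivc hdivp)
        (fun k => (m ((ofBiKummerData h toB Q odd_l R ιX hopen σ K' constEmb constEmb_injective hdivc hdivp).diffCocycle H k))⁻¹) :=
  fun _ => (inv_inv _).symm

/-- **The residual of F-0521 at the assembled data, `ι := id`**: "there is a cocycle OF THE CLASS `η̈^Θ` mod `N` satisfying the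
Prop. 5.2 (iii) dictionary" iff the transported bi-Kummer difference cocycle `k ↦ m(d(k))⁻¹` lies in `T.thetaCocycles` (abc-iut-f-116's
`exists_thetaSectionCompat_mem_iff` without the transport).  [cite: MochizukiEtTh2009, Prop 5.2 (iii) p.324 (PDF p.98)] -/
theorem exists_thetaSectionCompat_mem_ofBiKummerData_iff
    (H : (ofBiKummerData h toB Q odd_l R ιX hopen σ K' constEmb constEmb_injective hdivc hdivp).Facts)
    (m : (ofBiKummerData h toB Q odd_l R ιX hopen σ K' constEmb constEmb_injective hdivc hdivp).muTorsion
        (ofBiKummerData h toB Q odd_l R ιX hopen σ K' constEmb constEmb_injective hdivc hdivp).BN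
        (ofBiKummerData h toB Q odd_l R ιX hopen σ K' constEmb constEmb_injective hdivc hdivp).N ≃* T.mu) :
    (∃ η ∈ T.thetaCocycles,
        (ofBiKummerData h toB Q odd_l R ιX hopen σ K' constEmb constEmb_injective hdivc hdivp).ThetaSectionCompat H T
          (MulEquiv.refl _) m (identifiesPiYdd_ofBiKummerData h toB Q odd_l R ιX hopen σ K' constEmb constEmb_injective hdivc hdivp) η) ↔
      (fun k : T.PiYdd =>
          (m ((ofBiKummerData h toB Q odd_l R ιX hopen σ K' constEmb constEmb_injective hdivc hdivp).diffCocycle H k))⁻¹) ∈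
        T.thetaCocycles :=
  (ofBiKummerData h toB Q odd_l R ιX hopen σ K' constEmb constEmb_injective hdivc hdivp).exists_thetaSectionCompat_mem_iff H T
    (MulEquiv.refl _) m (identifiesPiYdd_ofBiKummerData h toB Q odd_l R ιX hopen σ K' constEmb constEmb_injective hdivc hdivp)

/-- **`hdies` for the transported cocycle is UNCONDITIONAL**: `∀ k ∈ Π^tp_Ÿ, ρ k = 1 → m(d(k))⁻¹ = 1` (the difference cocycle factors
through `ρ`, abc-iut-L6-t23's `diffCocycle_eq_one_of_rho_eq_one`).  [cite: MochizukiEtTh2009, §5 p.331 (PDF p.105)] -/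
theorem hdies_ofBiKummerData_transport
    (H : (ofBiKummerData h toB Q odd_l R ιX hopen σ K' constEmb constEmb_injective hdivc hdivp).Facts)
    (m : (ofBiKummerData h toB Q odd_l R ιX hopen σ K' constEmb constEmb_injective hdivc hdivp).muTorsion
        (ofBiKummerData h toB Q odd_l R ιX hopen σ K' constEmb constEmb_injective hdivc hdivp).BN
        (ofBiKummerData h toB Q odd_l R ιX hopen σ K' constEmb constEmb_injective hdivc hdivp).N ≃* T.mu) :
    ∀ k : T.PiYdd, (ofBiKummerData h toB Q odd_l R ιX hopen σ K' constEmb constEmb_injective hdivc hdivp).ρ (k : T.PiX) = 1 →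
      (m ((ofBiKummerData h toB Q odd_l R ιX hopen σ K' constEmb constEmb_injective hdivc hdivp).diffCocycle H k))⁻¹ = 1 := by
  intro k hk
  rw [(ofBiKummerData h toB Q odd_l R ιX hopen σ K' constEmb constEmb_injective hdivc hdivp).diffCocycle_eq_one_of_rho_eq_one H k hk,
    map_one, inv_one]

end OfBiKummerData

/-! ### At the junction `ofThetaSettingData` (the §5 data OF THE §1 SETTING) -/

section Junction

variable {p : ℕ} [Fact p.Prime] {D : ThetaSetting p} {E : D.EtaleThetaData} {l : ℕ} {C : E.DoubleUnderline l}
  {e : D.toTemperedCurve.GroupLevelData} {N : ℕ+} (μ : D.CyclotomeMod l N) (hC : D.Compat) (hS : D.Sec2Hyps)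
  {D₀ : Type} [Category.{v₀} D₀] {V : FrdIMonoidStub.{0}} {T₀ : RealifiedDivisorMonoids (D₀ := D₀) V}
  {VD : FrdICatStub.{1, 0, 0} (ConnectedPart (BTemp (C.temperedArithmeticGroup e).Pi))}
  {tf : TemperedFrobenioid T₀ (ConnectedPart (BTemp (C.temperedArithmeticGroup e).Pi)) VD} {hZ : tf.monoidType = MonoidType.Z}
  {hP : ∀ A : (ConnectedPart (BTemp (C.temperedArithmeticGroup e).Pi))ᵒᵖ, IsPerfect (tf.Φ.carrier A)}
  {NH : Subgroup (Field.absoluteGaloisGroup D.K) → tf.category → ℕ+ → Prop} {A₀ : tf.category}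
  {hA₀ : PreFrobenioid.IsFrobeniusTrivial tf.toElem A₀} {hA₀' : SemiGraphs.IsGaloisObj A₀.base.obj}
  {pullFrac : ∀ {A A' : (BiKummerSetting.mkOfConnectedTemperoid (C.temperedArithmeticGroup e) tf hZ hP NH A₀ hA₀ hA₀').C} (_ : A' ⟶ A),
    (BiKummerSetting.mkOfConnectedTemperoid (C.temperedArithmeticGroup e) tf hZ hP NH A₀ hA₀ hA₀').biratUnits A →
      (BiKummerSetting.mkOfConnectedTemperoid (C.temperedArithmeticGroup e) tf hZ hP NH A₀ hA₀ hA₀').biratUnits A'}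
  {θ : (BiKummerSetting.mkOfConnectedTemperoid (C.temperedArithmeticGroup e) tf hZ hP NH A₀ hA₀ hA₀').biratUnits
    (BiKummerSetting.mkOfConnectedTemperoid (C.temperedArithmeticGroup e) tf hZ hP NH A₀ hA₀ hA₀').Aodot}
  {Bl : (BiKummerSetting.mkOfConnectedTemperoid (C.temperedArithmeticGroup e) tf hZ hP NH A₀ hA₀ hA₀').C}
  {Pl : (BiKummerSetting.mkOfConnectedTemperoid (C.temperedArithmeticGroup e) tf hZ hP NH A₀ hA₀ hA₀').FractionPair θ Bl}
  {Rl : (BiKummerSetting.mkOfConnectedTemperoid (C.temperedArithmeticGroup e) tf hZ hP NH A₀ hA₀ hA₀').NthRoot θ Pl C.lPNat pullFrac}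
  (h : ModelFrobenioid.Hypotheses tf.divisorMonoid tf.ratFnFunctor)
  (Q : FrobenioidTheta.ThetaSubquotientStub.{0} (ConnectedPart (BTemp (C.temperedArithmeticGroup e).Pi)))
  (R : (BiKummerSetting.mkOfConnectedTemperoid (C.temperedArithmeticGroup e) tf hZ hP NH A₀ hA₀ hA₀').NthRoot Rl.root Rl.pair N pullFrac)
  (K' : Type) [Field K'] (constEmb : K'ˣ →* tf.biratUnitsModel R.BN) (constEmb_injective : Function.Injective constEmb)
  (hinvc : ∀ g : Aut R.AN.base,
    pull tf.divisorMonoid g.hom (ModelFrobenioid.div R.pair.num) = ModelFrobenioid.div R.pair.num)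
  (hinvp : ∀ y : (C.thetaEnvData μ hC hS).PiX, y ∈ (C.thetaEnvData μ hC hS).PiYdd →
    pull tf.divisorMonoid ((BiKummerSetting.mkOfConnectedTemperoid (C.temperedArithmeticGroup e) tf hZ hP NH A₀ hA₀ hA₀').galoisSurj
      R.AN.base R.αData.isGalois ((ContinuousMulEquiv.refl _) y)).hom (ModelFrobenioid.div R.pair.den) = ModelFrobenioid.div R.pair.den)

/-- **`hYdd` at the junction**: `𝔉.PiYdd = Π^tp_Ÿ̲̲ = Π^tp_Ÿ ∩ Π^tp_X̲̲ = T.PiYdd` on the nose (`ofThetaSettingData_PiYdd`), so `IdentifiesPiYdd` holds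
for `id`.  [cite: MochizukiEtTh2009, §5 p.330 (PDF p.104); Lem 5.9 (iv) p.332 (PDF p.106)] -/
theorem identifiesPiYdd_ofThetaSettingData :
    (ofThetaSettingData μ hC hS h Q R K' constEmb constEmb_injective hinvc hinvp).IdentifiesPiYdd (C.thetaEnvData μ hC hS)
      (MulEquiv.refl _) :=
  fun _ => Iff.rfl

/-- **F-1306 AT THE JUNCTION from the `tf`-side constants dictionary ALONE** (Lemma 5.8 proof, p. 331 (PDF p. 105): "`Π^tp_Y` [i.e., `G_K`,
via the natural surjection `Π^tp_Y ↠ G_K`] acts … via multiplication by an element of `μ_N(B_N)`"): conjugation by `s^⊓-gp_N(ρ g)`,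
`g ∈ Π^tp_X̲̲`, on `μ_N(B_N)` is the cyclotomic character `χ(aug g)` of the SETTING under `m : μ_N(B_N) ≃ μ_N(ℚ̄_p)` — abc-iut-L2-t11's
`cyclotomicCharacterCompatX_of_galoisDictionary` at `𝔉 := ofThetaSettingData`, `α :=` the natural birational action
(`biratAutAction_ofConnectedTemperoidData hconst`), with the `T`-side binders DISCHARGED at the Setting by abc-iut-L2-t11's
`Sec2GaloisDictionaryOfSetting`: `e := fixingSubgroupMulEquiv K refl : G_K ≃* Gal(ℚ̄_p/K)`, `j := μ_N(ℚ̄_p) ↪ ℚ̄_p^×` (injective),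
`hchi := thetaEnvData_chi_dictionary`.  Residual = {`hconst`, `hK`, `ν`, `hνμ`, `hνeq`}: the `N`-th roots of constants
`(K^×)^{1/N} ⊆ O^×(B_N^birat)` of `tf` ARE `p`-adic algebraic numbers (`ν`), compatibly with `m` on `μ_N(B_N)` (`hνμ`), and `Π^tp_X̲̲`
acts on them through `G_K` (`hνeq`) — the single origin clause that also yields `hgeom` / `hKumC` / `hroot` (same file of abc-iut-L2-t11).
[cite: MochizukiEtTh2009, Lem 5.8 proof p.331 (PDF p.105); Def 2.10 p.270 (PDF p.44)] -/
theorem cyclotomicCharacterCompatX_ofThetaSettingData_of_constantsDictionary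
    (hconst : ∀ (ε : Aut R.BN) (k : K'ˣ), tf.biratAutModel R.BN ε (constEmb k) = constEmb k)
    (hK : (ofThetaSettingData μ hC hS h Q R K' constEmb constEmb_injective hinvc hinvp).KxRootNModCyclotome)
    (m : (ofThetaSettingData μ hC hS h Q R K' constEmb constEmb_injective hinvc hinvp).muTorsion
        (ofThetaSettingData μ hC hS h Q R K' constEmb constEmb_injective hinvc hinvp).BN
        (ofThetaSettingData μ hC hS h Q R K' constEmb constEmb_injective hinvc hinvp).N ≃* MuN p N)
    (ν : (ofThetaSettingData μ hC hS h Q R K' constEmb constEmb_injective hinvc hinvp).KxRootN →* (PadicAlgCl p)ˣ)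
    (hνμ : ∀ u : (ofThetaSettingData μ hC hS h Q R K' constEmb constEmb_injective hinvc hinvp).muTorsion
        (ofThetaSettingData μ hC hS h Q R K' constEmb constEmb_injective hinvc hinvp).BN
        (ofThetaSettingData μ hC hS h Q R K' constEmb constEmb_injective hinvc hinvp).N,
      ν ⟨(ofThetaSettingData μ hC hS h Q R K' constEmb constEmb_injective hinvc hinvp).muToBirat u,
          (ofThetaSettingData μ hC hS h Q R K' constEmb constEmb_injective hinvc hinvp).muToBirat_mem_KxRootN u⟩ =
        (rootsOfUnity N (PadicAlgCl p)).subtype (m u))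
    (hνeq : ∀ (f : (ofThetaSettingData μ hC hS h Q R K' constEmb constEmb_injective hinvc hinvp).KxRootN) (y : C.Huu),
      (rootsOfUnity N (PadicAlgCl p)).subtype (m ((biratAutAction_ofConnectedTemperoidData (T := C.thetaEnvData μ hC hS) h Q C.odd_lPNat R
          (ContinuousMulEquiv.refl _) K' constEmb constEmb_injective hinvc hinvp hconst).kummerCocycle hK f
          ((ofThetaSettingData μ hC hS h Q R K' constEmb constEmb_injective hinvc hinvp).sgpCap
            ((ofThetaSettingData μ hC hS h Q R K' constEmb constEmb_injective hinvc hinvp).ρ y)))) * ν f =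
        Literature.FieldTheory.Galois.fixingSubgroupMulEquiv D.K (AlgEquiv.refl : PadicAlgCl p ≃ₐ[D.K] PadicAlgCl p)
          ((C.thetaEnvData μ hC hS).aug y) • ν f) :
    (ofThetaSettingData μ hC hS h Q R K' constEmb constEmb_injective hinvc hinvp).CyclotomicCharacterCompatX (C.thetaEnvData μ hC hS)
      (MulEquiv.refl _) m :=
  BiratAutAction.cyclotomicCharacterCompatX_of_galoisDictionary _ hK (C.thetaEnvData μ hC hS) (ContinuousMulEquiv.refl _) m _
    (rootsOfUnity N (PadicAlgCl p)).subtype ν (rootsOfUnity N (PadicAlgCl p)).subtype_injective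
    (C.thetaEnvData_chi_dictionary μ hC hS) hνμ hνeq

/-- **(D1) at the junction from the constants dictionary** (abc-iut-L6-t23's `hD1_…_of_compatX` fed by the theorem above): every
`g ∈ Π^tp_X̲̲` in `Ker ρ_N` acts trivially on `μ_N(ℚ̄_p)` — "`K_{A_N} ⊇ μ_N`" (Def. 4.1 (iii)(a)) read on the Setting.
[cite: MochizukiEtTh2009, Def 4.1 (iii) p.313 (PDF p.87); Lem 5.8 proof p.331 (PDF p.105)] -/
theorem hD1_ofThetaSettingData_of_constantsDictionary
    (hconst : ∀ (ε : Aut R.BN) (k : K'ˣ), tf.biratAutModel R.BN ε (constEmb k) = constEmb k)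
    (hK : (ofThetaSettingData μ hC hS h Q R K' constEmb constEmb_injective hinvc hinvp).KxRootNModCyclotome)
    (m : (ofThetaSettingData μ hC hS h Q R K' constEmb constEmb_injective hinvc hinvp).muTorsion
        (ofThetaSettingData μ hC hS h Q R K' constEmb constEmb_injective hinvc hinvp).BN
        (ofThetaSettingData μ hC hS h Q R K' constEmb constEmb_injective hinvc hinvp).N ≃* MuN p N)
    (ν : (ofThetaSettingData μ hC hS h Q R K' constEmb constEmb_injective hinvc hinvp).KxRootN →* (PadicAlgCl p)ˣ)
    (hνμ : ∀ u : (ofThetaSettingData μ hC hS h Q R K' constEmb constEmb_injective hinvc hinvp).muTorsion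
        (ofThetaSettingData μ hC hS h Q R K' constEmb constEmb_injective hinvc hinvp).BN
        (ofThetaSettingData μ hC hS h Q R K' constEmb constEmb_injective hinvc hinvp).N,
      ν ⟨(ofThetaSettingData μ hC hS h Q R K' constEmb constEmb_injective hinvc hinvp).muToBirat u,
          (ofThetaSettingData μ hC hS h Q R K' constEmb constEmb_injective hinvc hinvp).muToBirat_mem_KxRootN u⟩ =
        (rootsOfUnity N (PadicAlgCl p)).subtype (m u))
    (hνeq : ∀ (f : (ofThetaSettingData μ hC hS h Q R K' constEmb constEmb_injective hinvc hinvp).KxRootN) (y : C.Huu),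
      (rootsOfUnity N (PadicAlgCl p)).subtype (m ((biratAutAction_ofConnectedTemperoidData (T := C.thetaEnvData μ hC hS) h Q C.odd_lPNat R
          (ContinuousMulEquiv.refl _) K' constEmb constEmb_injective hinvc hinvp hconst).kummerCocycle hK f
          ((ofThetaSettingData μ hC hS h Q R K' constEmb constEmb_injective hinvc hinvp).sgpCap
            ((ofThetaSettingData μ hC hS h Q R K' constEmb constEmb_injective hinvc hinvp).ρ y)))) * ν f =
        Literature.FieldTheory.Galois.fixingSubgroupMulEquiv D.K (AlgEquiv.refl : PadicAlgCl p ≃ₐ[D.K] PadicAlgCl p)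
          ((C.thetaEnvData μ hC hS).aug y) • ν f) :
    ∀ g : C.Huu, (ofThetaSettingData μ hC hS h Q R K' constEmb constEmb_injective hinvc hinvp).ρ g = 1 →
      (C.thetaEnvData μ hC hS).chi ((C.thetaEnvData μ hC hS).aug g) = 1 :=
  fun g hg =>
    (ofThetaSettingData μ hC hS h Q R K' constEmb constEmb_injective hinvc hinvp).chi_aug_iota_eq_one_of_rho_eq_one_of_compatX
      (C.thetaEnvData μ hC hS) (MulEquiv.refl _) m
      (cyclotomicCharacterCompatX_ofThetaSettingData_of_constantsDictionary μ hC hS h Q R K' constEmb constEmb_injective hinvc hinvp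
        hconst hK m ν hνμ hνeq) g hg

/-- **F-0521 AT THE JUNCTION, solved form**: for the §5 data of the Setting the Prop. 5.2 (iii) dictionary for a cocycle
`η : Π^tp_Ÿ̲̲ → μ_N(ℚ̄_p)` reads `∀ k ∈ Π^tp_Ÿ̲̲, m(s^⊔-gp_N(ρ k) · s^⊓-gp_N(ρ k)⁻¹) = η(k)⁻¹` — no transport (`ι := id`, `hYdd := Iff.rfl`).
[cite: MochizukiEtTh2009, Prop 5.2 (iii) p.324 (PDF p.98)] -/
theorem thetaSectionCompat_ofThetaSettingData_iff
    (H : (ofThetaSettingData μ hC hS h Q R K' constEmb constEmb_injective hinvc hinvp).Facts)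
    (m : (ofThetaSettingData μ hC hS h Q R K' constEmb constEmb_injective hinvc hinvp).muTorsion
        (ofThetaSettingData μ hC hS h Q R K' constEmb constEmb_injective hinvc hinvp).BN
        (ofThetaSettingData μ hC hS h Q R K' constEmb constEmb_injective hinvc hinvp).N ≃* MuN p N)
    (η : (C.thetaEnvData μ hC hS).PiYdd → MuN p N) :
    (ofThetaSettingData μ hC hS h Q R K' constEmb constEmb_injective hinvc hinvp).ThetaSectionCompat H (C.thetaEnvData μ hC hS)
        (MulEquiv.refl _) m (identifiesPiYdd_ofThetaSettingData μ hC hS h Q R K' constEmb constEmb_injective hinvc hinvp) η ↔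
      ∀ k : (C.thetaEnvData μ hC hS).PiYdd,
        m ((ofThetaSettingData μ hC hS h Q R K' constEmb constEmb_injective hinvc hinvp).diffCocycle H k) = (η k)⁻¹ :=
  Iff.rfl

/-- The dictionary HOLDS at the junction for the transported cocycle `η_𝔉 := k ↦ m(d(k))⁻¹` (the unique solution, abc-iut-f-116).
[cite: MochizukiEtTh2009, Prop 5.2 (iii) p.324 (PDF p.98)] -/
theorem thetaSectionCompat_ofThetaSettingData_transport
    (H : (ofThetaSettingData μ hC hS h Q R K' constEmb constEmb_injective hinvc hinvp).Facts)
    (m : (ofThetaSettingData μ hC hS h Q R K' constEmb constEmb_injective hinvc hinvp).muTorsion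
        (ofThetaSettingData μ hC hS h Q R K' constEmb constEmb_injective hinvc hinvp).BN
        (ofThetaSettingData μ hC hS h Q R K' constEmb constEmb_injective hinvc hinvp).N ≃* MuN p N) :
    (ofThetaSettingData μ hC hS h Q R K' constEmb constEmb_injective hinvc hinvp).ThetaSectionCompat H (C.thetaEnvData μ hC hS)
        (MulEquiv.refl _) m (identifiesPiYdd_ofThetaSettingData μ hC hS h Q R K' constEmb constEmb_injective hinvc hinvp)
        (fun k => (m ((ofThetaSettingData μ hC hS h Q R K' constEmb constEmb_injective hinvc hinvp).diffCocycle H k))⁻¹) :=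
  fun _ => (inv_inv _).symm

/-- **THE RESIDUAL OF F-0521 AT THE JUNCTION = Prop. 5.2 (iii) at the Setting**: "some cocycle of the class `η̲̈^{Θ,l·ℤ×μ₂}` mod `N`
satisfies the dictionary" iff **the transported bi-Kummer difference cocycle `k ↦ m(s^⊔-gp_N(ρ k)·s^⊓-gp_N(ρ k)⁻¹)⁻¹` of the §5 data of the
Setting lies in `C.thetaCocycles hC μ`** — the reductions mod `N` of the `Π^tp_X̲̲`-conjugates of the restriction of the étale theta class
`η̈^Θ` to `Π^tp_Ÿ̲̲` (abc-iut-L2-t8's `thetaEnvData_thetaCocycles`): "the Kummer class determined by the bi-Kummer `N`-th root …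
corresponds precisely to the reduction modulo `N` of the class `η̲̈^Θ`" (p. 324).  While the «`Θ̈`» slot `θ` of the junction is a free
parameter this membership is an ORIGIN CLAUSE (GAP-LEDGER G-L2t4-2: pin `θ := Θ̈`), not a theorem.
[cite: MochizukiEtTh2009, Prop 5.2 (iii) p.324 (PDF p.98); Def 2.13 p.273 (PDF p.47)] -/
theorem exists_thetaSectionCompat_mem_ofThetaSettingData_iff
    (H : (ofThetaSettingData μ hC hS h Q R K' constEmb constEmb_injective hinvc hinvp).Facts)
    (m : (ofThetaSettingData μ hC hS h Q R K' constEmb constEmb_injective hinvc hinvp).muTorsion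
        (ofThetaSettingData μ hC hS h Q R K' constEmb constEmb_injective hinvc hinvp).BN
        (ofThetaSettingData μ hC hS h Q R K' constEmb constEmb_injective hinvc hinvp).N ≃* MuN p N) :
    (∃ η ∈ C.thetaCocycles hC μ,
        (ofThetaSettingData μ hC hS h Q R K' constEmb constEmb_injective hinvc hinvp).ThetaSectionCompat H (C.thetaEnvData μ hC hS)
          (MulEquiv.refl _) m (identifiesPiYdd_ofThetaSettingData μ hC hS h Q R K' constEmb constEmb_injective hinvc hinvp) η) ↔
      (fun k : (C.thetaEnvData μ hC hS).PiYdd =>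
          (m ((ofThetaSettingData μ hC hS h Q R K' constEmb constEmb_injective hinvc hinvp).diffCocycle H k))⁻¹) ∈
        C.thetaCocycles hC μ :=
  (ofThetaSettingData μ hC hS h Q R K' constEmb constEmb_injective hinvc hinvp).exists_thetaSectionCompat_mem_iff H
    (C.thetaEnvData μ hC hS) (MulEquiv.refl _) m
    (identifiesPiYdd_ofThetaSettingData μ hC hS h Q R K' constEmb constEmb_injective hinvc hinvp)

/-- **abc-iut-L6-t23's `hdies` at the junction is UNCONDITIONAL for the transported cocycle**: on `Ker ρ_N ∩ Π^tp_Ÿ̲̲ = N_{A_N} ∩ Π^tp_Ÿ̲̲`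
(`rho_ofThetaSettingData_eq_one_iff`) the cocycle `k ↦ m(d(k))⁻¹` is `1` — no dictionary, no saturation clause.
[cite: MochizukiEtTh2009, §5 p.331 (PDF p.105); Def 4.1 (iii) p.313 (PDF p.87)] -/
theorem hdies_ofThetaSettingData
    (H : (ofThetaSettingData μ hC hS h Q R K' constEmb constEmb_injective hinvc hinvp).Facts)
    (m : (ofThetaSettingData μ hC hS h Q R K' constEmb constEmb_injective hinvc hinvp).muTorsion
        (ofThetaSettingData μ hC hS h Q R K' constEmb constEmb_injective hinvc hinvp).BN
        (ofThetaSettingData μ hC hS h Q R K' constEmb constEmb_injective hinvc hinvp).N ≃* MuN p N) :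
    ∀ k : (C.thetaEnvData μ hC hS).PiYdd,
      (ofThetaSettingData μ hC hS h Q R K' constEmb constEmb_injective hinvc hinvp).ρ (k : C.Huu) = 1 →
        (m ((ofThetaSettingData μ hC hS h Q R K' constEmb constEmb_injective hinvc hinvp).diffCocycle H k))⁻¹ = 1 := by
  intro k hk
  rw [(ofThetaSettingData μ hC hS h Q R K' constEmb constEmb_injective hinvc hinvp).diffCocycle_eq_one_of_rho_eq_one H k hk,
    map_one, inv_one]

/-- The same on the stabiliser of a point `a` of the Galois `Π^tp_X̲̲`-set `A_N^bs` (the kernel `Ker ρ_N = N_{A_N}` read on the Setting,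
abc-iut-L2-t4's `rho_ofThetaSettingData_eq_one_iff`).  [cite: MochizukiEtTh2009, §5 p.331 (PDF p.105)] [cite: MochizukiSemiAnbd2006, Rmk 3.1.3 p.34] -/
theorem diffCocycle_transport_eq_one_of_fixes_AN
    (H : (ofThetaSettingData μ hC hS h Q R K' constEmb constEmb_injective hinvc hinvp).Facts)
    (m : (ofThetaSettingData μ hC hS h Q R K' constEmb constEmb_injective hinvc hinvp).muTorsion
        (ofThetaSettingData μ hC hS h Q R K' constEmb constEmb_injective hinvc hinvp).BN
        (ofThetaSettingData μ hC hS h Q R K' constEmb constEmb_injective hinvc hinvp).N ≃* MuN p N)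
    (a : R.AN.base.obj.obj.V) (k : (C.thetaEnvData μ hC hS).PiYdd) (hk : R.AN.base.obj.obj.ρ (k : C.Huu) a = a) :
    (m ((ofThetaSettingData μ hC hS h Q R K' constEmb constEmb_injective hinvc hinvp).diffCocycle H k))⁻¹ = 1 :=
  hdies_ofThetaSettingData μ hC hS h Q R K' constEmb constEmb_injective hinvc hinvp H m k
    ((rho_ofThetaSettingData_eq_one_iff μ hC hS h Q R K' constEmb constEmb_injective hinvc hinvp a k).mpr hk)

end Junction

end ThetaFrobenioid

end Literature.AnabelianGeometry.EtaleTheta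

end
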